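import Summits.CriticalPhenomena.PercolationContinuityZ3.Theorems.PercNearOneGluingNoHeavyLowerTailThreePartitionPairSaturation
import Summits.CriticalPhenomena.PercolationContinuityZ3.Theorems.PercNearOneGluingNoHeavyLowerTailThreePartitionCombBridgeConverse
import Mathlib.Order.Preorder.Finite
import Mathlib.Order.Hom.CompleteLattice

/-!
# Pair saturation on the cube: ORDER-THEORETIC TOOLS — co-generators of non-members, free co-generators, transport of the pair
# conditions and of the relative dual cone along an order isomorphism, coordinate permutations

Support file (cell `prim-sahi`, seat `prim-sahi-typer` gen 34; `--supports stmt-CriticalPhenomena-4575`).  Pure; no `sorry`, standard axioms.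
These are the order-theoretic lemmas through which the six-letter pair-saturation checker (`ThreePartition.Cube.chunkCheck`) is read back into
`PairSat.InDualRel` / `PairSat.PairCond` (`…ThreePartitionPairSaturation`):
* `PairSat.exists_coGen_ge_of_not_mem` — in a finite poset every non-member of `A` lies below a maximal non-member (a co-generator);
  `PairSat.mem_of_coGen_free` — an up-set whose co-generators are free w.r.t. `N` contains every element not below a free element
  (this is why the checker may test the RELATIVE criterion "outside `↓Free`");
* `PairSat.PairCond.symm`, `PairSat.PairCond.disjoint_coGen`, `PairSat.PairCond.lt_free` — the two co-generator sets of a conditioned pair are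
  disjoint and form an antichain (a 2-coloured antichain);
* `PairSat.mapIso` and the transport lemmas `coGen_mapIso`, `minEl_mapIso`, `free_mapIso_iff`, `pairCond_mapIso`, **`inDualRel_of_mapIso`**;
* the cube: `ThreePartition.threePartNT_perm` (the profile is invariant under a coordinate permutation acting on everything, from
  `threePartNT_comap_equiv`) and **`ThreePartition.inDualRel_profile_of_perm`** — the relative dual-cone statement for `(A, B, τ)` follows from
  the one for the permuted data; `PairSat.mem_minEl_iff_sdiff_singleton` — minimal elements of an up-set of sets = members all of whose lower
  covers are non-members (the checker's `minMask`). [this work]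
-/

namespace Summit.CriticalPhenomena.PercolationContinuityZ3.Theorems

open Finset

open scoped Classical

namespace PairSat

section General

variable {α : Type*} [Fintype α] [PartialOrder α]

/-- **Every non-member lies below a co-generator** (a maximal non-member), in a finite poset. [this work] -/
theorem exists_coGen_ge_of_not_mem {A : Finset α} {y : α} (hy : y ∉ A) : ∃ a ∈ coGen A, y ≤ a := by
  classical
  obtain ⟨b, hyb, hb⟩ := (univ.filter fun z => z ∉ A).exists_le_maximal (a := y) (mem_filter.2 ⟨mem_univ _, hy⟩)
  refine ⟨b, mem_coGen.2 ⟨(mem_filter.1 hb.1).2, fun z hbz => ?_⟩, hyb⟩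
  by_contra hz
  exact absurd (hb.2 (mem_filter.2 ⟨mem_univ _, hz⟩) hbz.le) (not_le_of_gt hbz)

/-- Below a co-generator of an up-set there are no members. [this work] -/
theorem not_mem_of_le_of_mem_coGen {A : Finset α} (hA : IsUpperSet (A : Set α)) {a y : α} (ha : a ∈ coGen A) (hy : y ≤ a) : y ∉ A :=
  fun h => (mem_coGen.1 ha).1 (hA hy h)

/-- Non-membership in an up-set ⇔ lying below a co-generator. [this work] -/
theorem not_mem_iff_exists_coGen_ge {A : Finset α} (hA : IsUpperSet (A : Set α)) {y : α} : y ∉ A ↔ ∃ a ∈ coGen A, y ≤ a :=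
  ⟨exists_coGen_ge_of_not_mem, fun ⟨_, ha, hy⟩ => not_mem_of_le_of_mem_coGen hA ha hy⟩

/-- **An up-set (indeed any finset) whose co-generators are free contains every element that is not below a free element.** [this work] -/
theorem mem_of_coGen_free {U N : Finset α} (hfree : ∀ q ∈ coGen U, Free N q) {y : α} (hy : ∀ q, Free N q → ¬ y ≤ q) : y ∈ U := by
  by_contra h
  obtain ⟨a, ha, hya⟩ := exists_coGen_ge_of_not_mem h
  exact hy a (hfree a ha) hya

omit [Fintype α] in
/-- `Free` is symmetric in the union. [this work] -/
theorem free_union_comm (M N : Finset α) (q : α) : Free (M ∪ N) q ↔ Free (N ∪ M) q := by rw [union_comm]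

/-- The pair conditions are symmetric. [this work] -/
theorem PairCond.symm {A B : Finset α} (h : PairCond A B) : PairCond B A where
  upA := h.upB
  upB := h.upA
  genA := h.genB
  genB := h.genA
  minA := fun m hm hmA => (free_union_comm _ _ _).1 (h.minB m hm hmA)
  minB := fun m hm hmB => (free_union_comm _ _ _).1 (h.minA m hm hmB)
  big := by
    obtain ⟨Q, hQf, hQa, h1, h2⟩ := h.big
    exact ⟨Q, fun q hq => (free_union_comm _ _ _).1 (hQf q hq), hQa, h2, h1⟩

/-- The two co-generator sets of a conditioned pair are disjoint. [this work] -/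
theorem PairCond.disjoint_coGen {A B : Finset α} (h : PairCond A B) : Disjoint (coGen A) (coGen B) := by
  classical
  rw [Finset.disjoint_left]
  intro x hxA hxB
  exact (mem_coGen.1 hxB).1 (h.genA hxA)

/-- No element of `coGen A` lies strictly below or above an element of `coGen B` (conditioned pair). [this work] -/
theorem PairCond.not_lt_of_mem_coGen {A B : Finset α} (h : PairCond A B) {x z : α} (hx : x ∈ coGen A) (hz : z ∈ coGen B) :
    ¬ x < z ∧ ¬ z < x := by
  refine ⟨fun hxz => (mem_coGen.1 hz).1 (h.upB hxz.le (h.genA hx)), fun hzx => (mem_coGen.1 hx).1 (h.upA hzx.le (h.genB hz))⟩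

/-- **The co-generators of a conditioned pair form an antichain.** [this work] -/
theorem PairCond.isAntichain_union {A B : Finset α} (h : PairCond A B) : IsAntichain (· ≤ ·) ((coGen A ∪ coGen B : Finset α) : Set α) := by
  classical
  intro x hx z hz hne hle
  rw [coe_union, Set.mem_union, mem_coe, mem_coe] at hx hz
  have hlt : x < z := lt_of_le_of_ne hle hne
  rcases hx with hx | hx <;> rcases hz with hz | hz
  · exact isAntichain_coGen A (mem_coe.2 hx) (mem_coe.2 hz) hne hle
  · exact (h.not_lt_of_mem_coGen hx hz).1 hlt
  · exact (h.symm.not_lt_of_mem_coGen hx hz).1 hlt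
  · exact isAntichain_coGen B (mem_coe.2 hx) (mem_coe.2 hz) hne hle

end General

/-! ### Transport along an order isomorphism -/

section Iso

variable {α β : Type*} [PartialOrder α] [PartialOrder β] (e : α ≃o β)

/-- The image of a finset under an order isomorphism. [this work] -/
def mapIso (A : Finset α) : Finset β := A.map e.toEquiv.toEmbedding

/-- Membership in the image. [this work] -/
theorem mem_mapIso {A : Finset α} {b : β} : b ∈ mapIso e A ↔ e.symm b ∈ A := by
  unfold mapIso
  rw [mem_map]
  constructor
  · rintro ⟨a, ha, rfl⟩; simpa using ha
  · intro h; exact ⟨e.symm b, h, by simp⟩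

/-- Membership of an image point. [this work] -/
@[simp] theorem apply_mem_mapIso {A : Finset α} {a : α} : e a ∈ mapIso e A ↔ a ∈ A := by
  rw [mem_mapIso, OrderIso.symm_apply_apply]

/-- The image as a set. [this work] -/
theorem coe_mapIso (A : Finset α) : (mapIso e A : Set β) = {b | e.symm b ∈ A} := by
  ext b; rw [mem_coe, mem_mapIso]; rfl

/-- Cardinality is preserved. [this work] -/
theorem card_mapIso (A : Finset α) : (mapIso e A).card = A.card := card_map _

/-- Unions are preserved (any decidability instances). [this work] -/
theorem mapIso_union [DecidableEq α] [DecidableEq β] (A B : Finset α) : mapIso e (A ∪ B) = mapIso e A ∪ mapIso e B := by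
  ext b; simp only [mem_mapIso, mem_union]

/-- Up-sets go to up-sets. [this work] -/
theorem isUpperSet_mapIso {A : Finset α} (h : IsUpperSet (A : Set α)) : IsUpperSet (mapIso e A : Set β) := by
  intro b b' hbb' hb
  rw [mem_coe, mem_mapIso] at hb ⊢
  exact h (e.symm.monotone hbb') hb

/-- Freeness is transported. [this work] -/
theorem free_mapIso_iff {N : Finset α} {q : α} : Free (mapIso e N) (e q) ↔ Free N q := by
  unfold Free
  constructor
  · intro h z hz
    have h1 := h (e z) ((apply_mem_mapIso e).2 hz)
    simpa using h1
  · intro h z hz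
    rw [mem_mapIso] at hz
    obtain ⟨h1, h2⟩ := h _ hz
    exact ⟨fun hle => h1 (by simpa using e.symm.monotone hle), fun hle => h2 (by simpa using e.symm.monotone hle)⟩

/-- Antichains go to antichains. [this work] -/
theorem isAntichain_mapIso {A : Finset α} (h : IsAntichain (· ≤ ·) (A : Set α)) : IsAntichain (· ≤ ·) (mapIso e A : Set β) := by
  intro x hx z hz hne hle
  rw [coe_mapIso] at hx hz
  exact h hx hz (fun heq => hne (e.symm.injective heq)) (e.symm.monotone hle)

variable [Fintype α] [Fintype β]

/-- Minimal elements are transported. [this work] -/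
theorem minEl_mapIso (A : Finset α) : minEl (mapIso e A) = mapIso e (minEl A) := by
  ext b
  rw [mem_minEl, mem_mapIso, mem_mapIso, mem_minEl]
  constructor
  · rintro ⟨h0, h⟩
    refine ⟨h0, fun y hy hyA => ?_⟩
    have h1 := e.strictMono hy
    rw [e.apply_symm_apply] at h1
    exact h (e y) h1 ((apply_mem_mapIso e).2 hyA)
  · rintro ⟨h0, h⟩
    refine ⟨h0, fun y hy hyA => ?_⟩
    rw [mem_mapIso] at hyA
    exact h (e.symm y) (e.symm.strictMono hy) hyA

/-- Co-generators are transported. [this work] -/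
theorem coGen_mapIso (A : Finset α) : coGen (mapIso e A) = mapIso e (coGen A) := by
  ext b
  simp only [mem_coGen, mem_mapIso]
  refine and_congr_right fun _ => ⟨fun h y hy => ?_, fun h y hy => ?_⟩
  · have h1 := e.strictMono hy
    rw [e.apply_symm_apply] at h1
    simpa using h (e y) h1
  · exact h (e.symm y) (e.symm.strictMono hy)

/-- **The pair conditions are transported along an order isomorphism.** [this work] -/
theorem pairCond_mapIso {A B : Finset α} (h : PairCond A B) : PairCond (mapIso e A) (mapIso e B) where
  upA := isUpperSet_mapIso e h.upA
  upB := isUpperSet_mapIso e h.upB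
  genA := by rw [coGen_mapIso]; intro b hb; rw [mem_mapIso] at hb ⊢; exact h.genA hb
  genB := by rw [coGen_mapIso]; intro b hb; rw [mem_mapIso] at hb ⊢; exact h.genB hb
  minA := fun b hb hbB => by
    rw [minEl_mapIso, mem_mapIso] at hb
    rw [mem_mapIso] at hbB
    rw [coGen_mapIso, coGen_mapIso, ← mapIso_union, ← e.apply_symm_apply b, free_mapIso_iff]
    exact h.minA _ hb hbB
  minB := fun b hb hbA => by
    rw [minEl_mapIso, mem_mapIso] at hb
    rw [mem_mapIso] at hbA
    rw [coGen_mapIso, coGen_mapIso, ← mapIso_union, ← e.apply_symm_apply b, free_mapIso_iff]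
    exact h.minB _ hb hbA
  big := by
    obtain ⟨Q, hQf, hQa, h1, h2⟩ := h.big
    refine ⟨mapIso e Q, fun q hq => ?_, isAntichain_mapIso e hQa, ?_, ?_⟩
    · rw [mem_mapIso] at hq
      rw [coGen_mapIso, coGen_mapIso, ← mapIso_union, ← e.apply_symm_apply q, free_mapIso_iff]
      exact hQf _ hq
    · rw [coGen_mapIso, card_mapIso, card_mapIso]; exact h1
    · rw [coGen_mapIso, card_mapIso, card_mapIso]; exact h2

/-- **Transport of the relative dual cone**: if `c'` on `β` pulls back to `c` along `e` and `c'` is in the relative dual cone w.r.t. the image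
of `N`, then `c` is in the relative dual cone w.r.t. `N`. [this work] -/
theorem inDualRel_of_mapIso {c : α → ℤ} {c' : β → ℤ} (hc : ∀ y, c' (e y) = c y) {N : Finset α} (h : InDualRel c' (mapIso e N)) :
    InDualRel c N := by
  intro U hU hfree
  have h1 := h (mapIso e U) (isUpperSet_mapIso e hU) (fun q hq => by
    rw [coGen_mapIso, mem_mapIso] at hq
    rw [← e.apply_symm_apply q, free_mapIso_iff]
    exact hfree _ hq)
  unfold mapIso at h1
  rw [sum_map] at h1
  simpa [hc] using h1

end Iso

/-! ### Minimal elements of an up-set of sets -/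

/-- **Minimal elements of an up-set of subsets**: the members all of whose lower covers `z \\ {i}` (`i ∈ z`) are non-members. [this work] -/
theorem mem_minEl_iff_sdiff_singleton {ι : Type*} [DecidableEq ι] [Fintype ι] {A : Finset (Set ι)} (hA : IsUpperSet (A : Set (Set ι)))
    {z : Set ι} : z ∈ minEl A ↔ z ∈ A ∧ ∀ i ∈ z, z \ {i} ∉ A := by
  rw [mem_minEl]
  constructor
  · rintro ⟨hz, hmin⟩
    refine ⟨hz, fun i hi => hmin _ ?_⟩
    refine lt_of_le_of_ne (fun x hx => hx.1) fun h => ?_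
    have : i ∈ z \ {i} := h.symm ▸ hi
    exact this.2 rfl
  · rintro ⟨hz, hcov⟩
    refine ⟨hz, fun y hy hyA => ?_⟩
    obtain ⟨i, hiz, hiy⟩ := Set.exists_of_ssubset hy
    refine hcov i hiz (hA (show y ≤ z \ {i} from fun j hj => ⟨hy.1 hj, fun h => hiy (h ▸ hj)⟩) hyA)

end PairSat

/-! ### The cube: coordinate permutations -/

namespace ThreePartition

variable {m : ℕ}

/-- A coordinate permutation acting on everything leaves the singleton profile unchanged. [this work] -/
theorem threePartNT_perm (σ : Equiv.Perm (Fin m)) (τ : Set (Fin m)) (A B : Finset (Set (Fin m))) (y : Set (Fin m)) :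
    threePartNT (σ '' τ) (↑(PairSat.mapIso σ.toOrderIsoSet A) : Set (Set (Fin m))) ↑(PairSat.mapIso σ.toOrderIsoSet B) {σ '' y} =
      threePartNT τ (↑A : Set (Set (Fin m))) ↑B {y} := by
  have h1 : ∀ C : Finset (Set (Fin m)), (↑(PairSat.mapIso σ.toOrderIsoSet C) : Set (Set (Fin m))) = comapFam σ.symm ↑C := fun C => by
    rw [PairSat.coe_mapIso]; ext T
    simp only [Set.mem_setOf_eq, comapFam, mem_coe]
    rw [show (σ.toOrderIsoSet).symm T = σ.symm '' T from rfl]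
  have h2 : ({σ '' y} : Set (Set (Fin m))) = comapFam σ.symm {y} := by
    ext T
    simp only [Set.mem_singleton_iff, comapFam, Set.mem_setOf_eq]
    constructor
    · rintro rfl; rw [← Set.image_comp]; simp
    · intro h; rw [← h, ← Set.image_comp]; simp
  have h3 : σ '' τ = σ.symm ⁻¹' τ := σ.image_eq_preimage_symm τ
  rw [h1, h1, h2, h3]
  exact threePartNT_comap_equiv σ.symm τ ↑A ↑B {y}

/-- **The relative dual-cone statement is invariant under coordinate permutations**: it holds for `(A, B, τ)` w.r.t. `N` as soon as it
holds for the permuted data `(σ·A, σ·B, σ·τ)` w.r.t. `σ·N` (use `PairSat.coGen_mapIso` / `PairSat.mapIso_union` to rewrite `σ·N` for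
`N = coGen A ∪ coGen B`). [this work] -/
theorem inDualRel_profile_of_perm (σ : Equiv.Perm (Fin m)) (τ : Set (Fin m)) (A B N : Finset (Set (Fin m)))
    (h : PairSat.InDualRel
      (fun y' : Set (Fin m) => threePartNT (σ '' τ) (↑(PairSat.mapIso σ.toOrderIsoSet A) : Set (Set (Fin m))) ↑(PairSat.mapIso σ.toOrderIsoSet B) {y'})
      (PairSat.mapIso σ.toOrderIsoSet N)) :
    PairSat.InDualRel (fun y : Set (Fin m) => threePartNT τ (↑A : Set (Set (Fin m))) ↑B {y}) N := by
  refine PairSat.inDualRel_of_mapIso σ.toOrderIsoSet (fun y => ?_) h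
  show threePartNT (σ '' τ) _ _ {σ.toOrderIsoSet y} = _
  rw [show σ.toOrderIsoSet y = σ '' y from rfl]
  exact threePartNT_perm σ τ A B y

end ThreePartition

end Summit.CriticalPhenomena.PercolationContinuityZ3.Theorems
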